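import Mathlib
import Summits.KontsevichZagierPeriods.Zeta5Search.UniversalDigitV
import HarnessLib

/-!
# ζ(5) search — harmonic sums modulo `p`: `H_{p−1} ≡ 0` and `N_{s,1} ≡ H_{s mod p}` (tools for gen-2 g10's (V2))

Cell `pub-zeta5` (HONEST FRAMING: systematic search; no irrationality claim unless certified), typer seat generation 11.
Two elementary congruences used by the second digit of the constant-term piece `V_x` (`SecondDigitVProof.lean`, REPORT-gen2-g10 §1
(V2): "`N_{k,1} ≡ ℓH_{p−1} + H_{k₀−1} ≡ H_{k₀−1} (mod p)`"):
* `padicNorm_harm_pred_le` — **`H_{p−1} ≡ 0 (mod p)`** for an odd prime (pairing `m ↔ p − m`);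
* `padicNorm_harmN_sub_le` — the prime-to-`p` part `N_{s,1} = H_s − p^{−1} H_{⌊s/p⌋}` of the harmonic sum satisfies
  **`N_{s,1} ≡ H_{s mod p} (mod p)`** (induction on `s`; each completed block of `p − 1` units is `≡ H_{p−1} ≡ 0`).
`p`-adic norms of rational numbers; nothing here concerns irrationality.
-/

noncomputable section

open Finset

namespace Summit.KontsevichZagierPeriods.Zeta5Search.SecondOrder

open Summit.KontsevichZagierPeriods.Zeta5Search.PadicSeries
open Summit.KontsevichZagierPeriods.Zeta5Search.CellA (padicNorm_p padicNorm_inv_sub_inv_le harm_succ)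
open Literature.NumberTheory.Transcendental.BallRivoal (harm)

variable {p : ℕ} [hp : Fact p.Prime]

/-! ### `H_{p−1} ≡ 0 (mod p)` and the prime-to-`p` harmonic sum modulo `p` -/

/-- **`H_{p−1} ≡ 0 (mod p)`** for an odd prime (pair `m ↔ p − m`). -/
theorem padicNorm_harm_pred_le (hp2 : p ≠ 2) : padicNorm p (harm 1 (p - 1)) ≤ (p : ℚ) ^ (-(1 : ℤ)) := by
  have h1p := hp.out.one_lt
  have htwo : padicNorm p (2 : ℚ) = 1 := by
    have := (padicNorm.nat_eq_one_iff (p := p) 2).2 (by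
      intro h; exact hp2 ((Nat.prime_dvd_prime_iff_eq hp.out Nat.prime_two).1 h))
    exact_mod_cast this
  -- `2 H_{p-1} = Σ_{j<p-1} (1/(j+1) + 1/(p-1-j)) = Σ p/((j+1)(p-1-j))`
  have hrefl : harm 1 (p - 1) = ∑ j ∈ range (p - 1), 1 / ((p : ℚ) - 1 - j) := by
    rw [harm, ← sum_range_reflect]
    refine sum_congr rfl fun j hj => ?_
    have hj' := mem_range.1 hj
    rw [pow_one, Nat.cast_sub (by omega), Nat.cast_sub (by omega), Nat.cast_sub h1p.le]
    push_cast; ring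
  have hsum : 2 * harm 1 (p - 1) = ∑ j ∈ range (p - 1), (p : ℚ) / (((j : ℚ) + 1) * ((p : ℚ) - 1 - j)) := by
    have h2 : 2 * harm 1 (p - 1) = harm 1 (p - 1) + ∑ j ∈ range (p - 1), 1 / ((p : ℚ) - 1 - j) := by
      rw [two_mul, ← hrefl]
    rw [h2, harm, ← sum_add_distrib]
    refine sum_congr rfl fun j hj => ?_
    have hj' := mem_range.1 hj
    have h1 : ((j : ℚ) + 1) ≠ 0 := by positivity
    have h2 : ((p : ℚ) - 1 - j) ≠ 0 := by
      have : ((j : ℚ) + 1) < p := by exact_mod_cast (show j + 1 < p by omega)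
      intro h; linarith
    rw [pow_one]; field_simp; ring
  have hnorm : padicNorm p (2 * harm 1 (p - 1)) ≤ (p : ℚ) ^ (-(1 : ℤ)) := by
    rw [hsum]
    refine padicNorm.sum_le' (fun j hj => ?_) (zpow_p_nonneg _)
    have hj' := mem_range.1 hj
    have hu1 : padicNorm p ((j : ℚ) + 1) = 1 := by
      have e : ((j : ℚ) + 1) = ((j + 1 : ℕ) : ℚ) := by push_cast; ring
      rw [e]
      have := (padicNorm.nat_eq_one_iff (p := p) (j + 1)).2 (fun h => by have := Nat.le_of_dvd (by omega) h; omega)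
      exact_mod_cast this
    have hu2 : padicNorm p ((p : ℚ) - 1 - j) = 1 := by
      have e : ((p : ℚ) - 1 - j) = ((p - 1 - j : ℕ) : ℚ) := by
        rw [Nat.cast_sub (by omega), Nat.cast_sub h1p.le]; push_cast; ring
      rw [e]
      have := (padicNorm.nat_eq_one_iff (p := p) (p - 1 - j)).2 (fun h => by have := Nat.le_of_dvd (by omega) h; omega)
      exact_mod_cast this
    rw [padicNorm.div, padicNorm.mul, hu1, hu2, mul_one, div_one, padicNorm_p]
  rwa [padicNorm.mul, htwo, one_mul] at hnorm

omit hp in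
/-- Successor arithmetic modulo `p`. -/
theorem succ_mod_cases {s : ℕ} (hp1 : 1 < p) :
    (p ∣ s + 1 → s % p = p - 1 ∧ (s + 1) % p = 0) ∧ (¬ p ∣ s + 1 → (s + 1) % p = s % p + 1) := by
  have hr : s % p < p := Nat.mod_lt _ (by omega)
  have hmod : (s + 1) % p = (s % p + 1) % p := by rw [Nat.add_mod, Nat.mod_eq_of_lt hp1]
  by_cases hlt : s % p + 1 < p
  · have h1 : (s + 1) % p = s % p + 1 := by rw [hmod, Nat.mod_eq_of_lt hlt]
    refine ⟨fun h => ?_, fun _ => h1⟩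
    have := Nat.mod_eq_zero_of_dvd h; omega
  · have heq : s % p + 1 = p := by omega
    have h0 : (s + 1) % p = 0 := by rw [hmod, heq, Nat.mod_self]
    exact ⟨fun _ => ⟨by omega, h0⟩, fun h => absurd (Nat.dvd_of_mod_eq_zero h0) h⟩

/-- **`N_{s,1} ≡ H_{s mod p} (mod p)`**: the prime-to-`p` part `H_s − p^{−1}H_{⌊s/p⌋}` of the harmonic sum is congruent to the
harmonic sum of the residue (each full block of `p − 1` units contributes `H_{p−1} ≡ 0`). -/
theorem padicNorm_harmN_sub_le (hp2 : p ≠ 2) (s : ℕ) :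
    padicNorm p (harm 1 s - harm 1 (s / p) / (p : ℚ) ^ 1 - harm 1 (s % p)) ≤ (p : ℚ) ^ (-(1 : ℤ)) := by
  have hp1 := hp.out.one_lt
  have hp0 : (p : ℚ) ≠ 0 := Nat.cast_ne_zero.2 hp.out.ne_zero
  have h00 : harm 1 0 = 0 := by simp [harm]
  induction s with
  | zero =>
    rw [Nat.zero_div, Nat.zero_mod, h00, zero_div, sub_zero, sub_zero, padicNorm.zero]; exact zpow_p_nonneg _
  | succ s ih =>
    rw [Nat.succ_div, harm_succ]
    by_cases hdvd : p ∣ s + 1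
    · obtain ⟨hsm, hs0⟩ := (succ_mod_cases (p := p) hp1).1 hdvd
      rw [if_pos hdvd, harm_succ, hs0, h00, sub_zero]
      obtain ⟨m, hm⟩ := hdvd
      have hm0 : 0 < m := by
        rcases Nat.eq_zero_or_pos m with rfl | h
        · omega
        · exact h
      have hdiv : (s / p : ℕ) = m - 1 := by
        have : s = p * (m - 1) + (p - 1) := by
          zify [hp1.le, hm0] at hm ⊢
          linarith
        rw [this, Nat.mul_add_div hp.out.pos, Nat.div_eq_of_lt (by omega)]
        omega
      have e : harm 1 s + 1 / ((s : ℚ) + 1) ^ 1 - (harm 1 (s / p) + 1 / (((s / p : ℕ) : ℚ) + 1) ^ 1) / (p : ℚ) ^ 1 =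
          (harm 1 s - harm 1 (s / p) / (p : ℚ) ^ 1 - harm 1 (s % p)) + harm 1 (p - 1) := by
        have hs1 : ((s : ℚ) + 1) = (p : ℚ) * m := by exact_mod_cast hm
        have hm1 : (((s / p : ℕ) : ℚ) + 1) = m := by
          rw [hdiv]; push_cast [Nat.cast_sub hm0]; ring
        rw [hs1, hm1, hsm]
        field_simp
        ring
      rw [e]
      exact (padicNorm.nonarchimedean (p := p)).trans (max_le ih (padicNorm_harm_pred_le hp2))
    · have hs1 := (succ_mod_cases (p := p) hp1).2 hdvd
      rw [if_neg hdvd, add_zero, hs1, harm_succ]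
      have e : harm 1 s + 1 / ((s : ℚ) + 1) ^ 1 - harm 1 (s / p) / (p : ℚ) ^ 1 -
          (harm 1 (s % p) + 1 / (((s % p : ℕ) : ℚ) + 1) ^ 1) =
          (harm 1 s - harm 1 (s / p) / (p : ℚ) ^ 1 - harm 1 (s % p)) +
            (((s : ℚ) + 1)⁻¹ - ((((s % p : ℕ) : ℚ)) + 1)⁻¹) := by ring
      rw [e]
      refine (padicNorm.nonarchimedean (p := p)).trans (max_le ih ?_)
      -- `1/(s+1) ≡ 1/(s % p + 1)`: congruent units
      have hr : s % p + 1 < p := by have := Nat.mod_lt (s + 1) (by omega : 0 < p); omega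
      have hu1 : padicNorm p ((s : ℚ) + 1) = 1 := by
        have e1 : ((s : ℚ) + 1) = ((s + 1 : ℕ) : ℚ) := by push_cast; ring
        rw [e1]; exact_mod_cast (padicNorm.nat_eq_one_iff (p := p) (s + 1)).2 hdvd
      have hu2 : padicNorm p ((((s % p : ℕ) : ℚ)) + 1) = 1 := by
        have e1 : ((((s % p : ℕ) : ℚ)) + 1) = ((s % p + 1 : ℕ) : ℚ) := by push_cast; ring
        rw [e1]
        exact_mod_cast (padicNorm.nat_eq_one_iff (p := p) (s % p + 1)).2
          (fun h => by have := Nat.le_of_dvd (by omega) h; omega)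
      refine padicNorm_inv_sub_inv_le hu1 hu2 ?_
      have e2 : ((s : ℚ) + 1) - ((((s % p : ℕ) : ℚ)) + 1) = (p : ℚ) * ((s / p : ℕ) : ℚ) := by
        have h := Nat.div_add_mod s p
        have e3 : ((s : ℚ)) = (p : ℚ) * ((s / p : ℕ) : ℚ) + ((s % p : ℕ) : ℚ) := by exact_mod_cast h.symm
        rw [e3]; ring
      rw [e2, padicNorm.mul, padicNorm_p]
      calc (p : ℚ) ^ (-(1 : ℤ)) * padicNorm p ((s / p : ℕ) : ℚ) ≤ (p : ℚ) ^ (-(1 : ℤ)) * 1 :=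
            mul_le_mul_of_nonneg_left (by simpa using padicNorm.of_nat (p := p) (s / p)) (zpow_p_nonneg _)
        _ = _ := mul_one _

end Summit.KontsevichZagierPeriods.Zeta5Search.SecondOrder

end
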